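import Mathlib
import Literature.NumberTheory.Transcendental.KZCalculus
import Summits.KontsevichZagierPeriods.KontsevichZagierPeriods.Theorems.TorsionLogsNeronTorsionSectorStubTranslationCalculus
import Summits.KontsevichZagierPeriods.KontsevichZagierPeriods.Theorems.TorsionLogsNeronTorsionSectorStubDlogPotential
import Summits.KontsevichZagierPeriods.KontsevichZagierPeriods.Theorems.TorsionLogsNeronTorsionSectorStubHaarReps
import Summits.KontsevichZagierPeriods.KontsevichZagierPeriods.Theorems.TorsionLogsNeronTorsionSectorStubLogStep
import Summits.KontsevichZagierPeriods.KontsevichZagierPeriods.Theorems.TorsionLogsNeronTorsionSectorStubCornerChartUpperAux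
import Summits.KontsevichZagierPeriods.KontsevichZagierPeriods.Theorems.TorsionLogsNeronTorsionSectorStubGridDataAux
import HarnessLib

/-!
# Stub `stub_lowerRegular` — crux `TorsionLogs.NeronTorsionSector`, line `registered` (block V2):
# real analysis of the lower branch

On the identity component `x ≥ e₁ > 0` of the real cubic `y² = f(x) = 4x³ − g₂x − g₃` (`e₁` the
largest root, `f > 0` on `(e₁, ∞)`) take the LOWER branch `yb = −√f`, an algebraic point
`P₁ = (x₁, y₁)` on it (`e₁ < x₁`, `y₁ < 0`), the tangential point `2P₁ = (x₂, y₂)` and the translation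
`τ` by `P₁` in REGULAR CHORD FORM: `sl = M(x)/(yb + y₁)`, `M(x) = 4x² + 4xx₁ + 4x₁² − g₂`,
`τ = sl²/4 − x − x₁`, `Y3 = −(yb + sl(τ − x))`, the third-kind potential `Qf`, the iterated chord
`(sl3, X33, Y33, Qf3)`, the polynomial `Pg` and the dlog potential `G` — literally the data of the
landed `stub_translationCalculus` / `stub_dlogPotential` with `ε = −1`.

We prove the real-analysis package `stub_lowerRegular`:
1. `yb + y₁ < 0` and `M > 0` on `[e₁, ∞)` (`M(x) ≥ M̃ := 4(e₁² + e₁x₁ + x₁²) − g₂ = f(x₁)/(x₁ − e₁) > 0`);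
2. the Haar identity `|τ′|√f = √(f∘τ)` (`τ′ = Y3/yb`, `Y3² = f∘τ`);
3. non-degeneracy on a cell `e₁ < x`, `e₁ < τ x < x₁`: `Y3 + y₁ ≠ 0` (else `f(τ x) = f(x₁)`,
   contradicting the strict monotonicity `gridData_cubic_lt`), `e₁ ≤ X33` (the chord through the two
   curve points `(τ x, Y3 x)`, `(x₁, y₁)` cuts out `φ(t) = f(t) − line(t)² = 4(t − τ x)(t − x₁)(t − X33)`,
   and `φ(e₁) = −line(e₁)² ≤ 0`), `Pg ≠ 0` (norm identity of `stub_dlogPotential` (ii) and the value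
   `Pg(x₂) = 8(x₂ + 2x₁)y₂ ≠ 0`), whence `G ≠ 0` and the dlog identity (`stub_dlogPotential` (i));
4. continuity of `τ`, `Y3`, `Qf` and the derivative of `Qf` (`stub_translationCalculus` (c));
5. `ℚ`-semialgebraicity of all the formula functions (closure rules, junk-tolerant division);
6. the sign `Y3 < 0` right of the grid point `x_{m−1}` (intermediate value theorem: `Y3` is continuous,
   `Y3² = f∘τ > 0`, `Y3(x₁) = y₂ < 0`);
7. where `Y3 < 0` the iterated chord is the iterated translation (`Y3 = yb∘τ`, unfolding).

References: J. H. Silverman, *The Arithmetic of Elliptic Curves* (2nd ed., 2009), III.2.3;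
S. Lang, *Fundamentals of Diophantine Geometry* (1983), Ch. 13 Thm 1.1; J. Bochnak, M. Coste,
M.-F. Roy, *Real Algebraic Geometry* (1998), Prop. 2.2.6.
-/

noncomputable section

open Set MeasureTheory
open Literature.NumberTheory.Transcendental Literature.ModelTheory.ExponentialFields

-- `Summit.KontsevichZagierPeriods.KontsevichZagierPeriods.…` is the tree's mandated layout (single-conjunct summit).
set_option linter.dupNamespace false

namespace Summit.KontsevichZagierPeriods.KontsevichZagierPeriods.Cruxes.NeronTorsionSector.Translation

/-! ### Helpers -/

/-- **The third intersection of a chord, as a polynomial identity.** If `y₁² = f(x₁)`,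
`s (W + y₁) = M(P)` and `W − y₁ = s (P − x₁)` (the chord through `(P, W)` and `(x₁, y₁)` in regular
form), then `f(t) − (y₁ + s(t − x₁))² = 4(t − P)(t − x₁)(t − X)` with `X = s²/4 − P − x₁`.
[cite: SilvermanAEC2009, III.2.3] -/
theorem lowerReg_third_root_identity {P W x₁ y₁ s g₂ g₃ : ℝ}
    (h0 : y₁ ^ 2 = 4 * x₁ ^ 3 - g₂ * x₁ - g₃)
    (hM : s * (W + y₁) = 4 * P ^ 2 + 4 * P * x₁ + 4 * x₁ ^ 2 - g₂)
    (hch : W - y₁ = s * (P - x₁)) (t : ℝ) :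
    4 * t ^ 3 - g₂ * t - g₃ - (y₁ + s * (t - x₁)) ^ 2
      = 4 * (t - P) * (t - x₁) * (t - (s ^ 2 / 4 - P - x₁)) := by
  linear_combination (x₁ - t) * hM + s * (t - x₁) * hch - h0

/-- **A chord through two points of the identity component meets the curve again on it.** With
`(P, W)`, `(x₁, y₁)` on `y² = f`, `W + y₁ ≠ 0`, the regular-form slope `s` and a root `e` of `f` with
`e < P`, `e < x₁`: the third abscissa `X = s²/4 − P − x₁` satisfies `e ≤ X`, because
`−line(e)² = f(e) − line(e)² = 4(e − P)(e − x₁)(e − X)` and `(e − P)(e − x₁) > 0`.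
[cite: SilvermanAEC2009, III.2.3] -/
theorem lowerReg_third_root {P W x₁ y₁ s g₂ g₃ e : ℝ} (h1 : W ^ 2 = 4 * P ^ 3 - g₂ * P - g₃)
    (h0 : y₁ ^ 2 = 4 * x₁ ^ 3 - g₂ * x₁ - g₃)
    (hM : s * (W + y₁) = 4 * P ^ 2 + 4 * P * x₁ + 4 * x₁ ^ 2 - g₂) (hne : W + y₁ ≠ 0)
    (he : 4 * e ^ 3 - g₂ * e - g₃ = 0) (heP : e < P) (hex : e < x₁) :
    e ≤ s ^ 2 / 4 - P - x₁ := by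
  have hch := translCalc_chord h1 h0 hM hne
  have key := lowerReg_third_root_identity h0 hM hch e
  rw [he] at key
  have hprod : 0 < (e - P) * (e - x₁) := mul_pos_of_neg_of_neg (sub_neg.2 heP) (sub_neg.2 hex)
  by_contra hlt
  push Not at hlt
  have h3 : 0 < 4 * ((e - P) * (e - x₁)) * (e - (s ^ 2 / 4 - P - x₁)) :=
    mul_pos (mul_pos four_pos hprod) (sub_pos.2 hlt)
  nlinarith [sq_nonneg (y₁ + s * (e - x₁))]

/-- **The chord numerator is positive on the identity component.** If `e₁ > 0` is a root of
`f = 4x³ − g₂x − g₃` with `f > 0` on `(e₁, ∞)` and `e₁ < x₁`, then for `e₁ ≤ x`: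
`M(x) = 4x² + 4xx₁ + 4x₁² − g₂ ≥ 4(e₁² + e₁x₁ + x₁²) − g₂ = f(x₁)/(x₁ − e₁) > 0`. [folklore] -/
theorem lowerReg_M_pos {g₂ g₃ e₁ x₁ : ℝ} {f : ℝ → ℝ} (hf : ∀ x, f x = 4 * x ^ 3 - g₂ * x - g₃)
    (he : f e₁ = 0) (hpos : ∀ x, e₁ < x → 0 < f x) (hx₁ : e₁ < x₁) {x : ℝ} (hx : e₁ ≤ x)
    (hx0 : 0 ≤ x + e₁ + x₁) : 0 < 4 * x ^ 2 + 4 * x * x₁ + 4 * x₁ ^ 2 - g₂ := by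
  have h1 := hpos x₁ hx₁
  rw [hf] at h1 he
  have hA : 0 < 4 * (x₁ ^ 2 + x₁ * e₁ + e₁ ^ 2) - g₂ := by
    have e : 4 * x₁ ^ 3 - g₂ * x₁ - g₃ = (x₁ - e₁) * (4 * (x₁ ^ 2 + x₁ * e₁ + e₁ ^ 2) - g₂) := by
      linear_combination he
    rw [e] at h1
    exact pos_of_mul_pos_right h1 (sub_pos.2 hx₁).le
  nlinarith [mul_nonneg (sub_nonneg.2 hx) hx0]

/-! ### The registered stub -/

/-- **STUB V2 (`stub_lowerRegular`, size L; real analysis of the lower branch).** On the identity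
component `x ≥ e₁ > 0` of `y² = f(x)`, lower branch `yb = −√f`, with `P₁ = (x₁, y₁)` (`y₁ < 0`) and
`2P₁ = (x₂, y₂)` (tangent formulas; `e₁ < x₂`, `y₂ < 0`; `xm1` stands for the grid point `x_{m−1}`,
`e₁ ≤ xm1 < x₁`): (1) `yb + y₁ < 0` and `M(x) = 4x²+4xx₁+4x₁²−g₂ > 0` on `[e₁, ∞)`; (2) Haar
invariance of the translation: `τ′ = Y3/yb`, `|τ′|√f = √f∘τ` wherever `e₁ < x`, `e₁ < τ x`
(`stub_translationCalculus`); (3) wherever moreover `τ x < x₁`: `Y3 + y₁ ≠ 0` (else `f(τ x) = f(x₁)`),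
`e₁ ≤ X33` (a chord through two points of the identity component meets the curve again on it:
`φ(e₁) = −line(e₁)² ≤ 0` for `φ(t) = f(t) − line(t)² = 4(t − τ x)(t − x₁)(t − X33 x)`), `Pg ≠ 0`
(norm identity of `stub_dlogPotential` (ii), `M ≠ 0`, and at `x = x₂`: `Pg = 8(x₂ + 2x₁)y₂ ≠ 0`),
hence `G ≠ 0` and the dlog identity of `stub_dlogPotential` (i); (4) continuity of `Qf` where
`τ x ≠ 0`, `x ≠ 0`, global continuity of `τ`, `Y3`, and `Qf′ = (h∘τ − h)/yb`; (5) `ℚ`-semialgebraicity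
of the formula functions on any `ℚ`-semialgebraic set; (6) the sign of `Y3` right of `x_{m−1}` by
continuity, `Y3² = f∘τ > 0` and `Y3(x₁) = y₂ < 0`; (7) where `Y3 < 0`, the iterated chord is the
iterated translation: `Qf3 = Qf∘τ`, `X33 = τ∘τ`, `Y3 = yb∘τ`.
[cite: SilvermanAEC2009, III.2.3] [cite: Lang1983, Ch. 13 Thm 1.1] [cite: BochnakCosteRoy1998, Prop. 2.2.6] -/
theorem stub_lowerRegular : ∀ (g₂ g₃ e₁ x₁ y₁ x₂ y₂ L₁ xm1 : ℝ) (f yb sl τ Y3 Qf sl3 X33 Y33 Qf3 Pg G τ' : ℝ → ℝ),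
    (∀ x, f x = 4 * x ^ 3 - g₂ * x - g₃) → f e₁ = 0 → 0 < e₁ → (∀ x, e₁ < x → 0 < f x) →
    e₁ < x₁ → y₁ ^ 2 = f x₁ → y₁ < 0 →
    L₁ = (12 * x₁ ^ 2 - g₂) / (2 * y₁) → x₂ = L₁ ^ 2 / 4 - 2 * x₁ → y₂ = -(y₁ + L₁ * (x₂ - x₁)) →
    e₁ < x₂ → y₂ < 0 →
    IsAlgebraic ℚ g₂ → IsAlgebraic ℚ g₃ → IsAlgebraic ℚ x₁ → IsAlgebraic ℚ y₁ →
    yb = (fun x => -Real.sqrt (f x)) →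
    sl = (fun x => (4 * x ^ 2 + 4 * x * x₁ + 4 * x₁ ^ 2 - g₂) / (yb x + y₁)) →
    τ = (fun x => sl x ^ 2 / 4 - x - x₁) →
    Y3 = (fun x => -(yb x + sl x * (τ x - x))) →
    Qf = (fun x => sl x / 2 + Y3 x / (2 * τ x) - yb x / (2 * x)) →
    sl3 = (fun x => (4 * τ x ^ 2 + 4 * τ x * x₁ + 4 * x₁ ^ 2 - g₂) / (Y3 x + y₁)) →
    X33 = (fun x => sl3 x ^ 2 / 4 - τ x - x₁) →
    Y33 = (fun x => -(Y3 x + sl3 x * (X33 x - τ x))) →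
    Qf3 = (fun x => sl3 x / 2 + Y33 x / (2 * X33 x) - Y3 x / (2 * τ x)) →
    Pg = (fun x => 4 * (x + 2 * x₁) * y₁ - L₁ * (4 * x ^ 2 + 4 * x * x₁ + 4 * x₁ ^ 2 - g₂)
      + 4 * (x + 2 * x₁) * yb x) →
    G = (fun x => Pg x / (yb x + y₁) ^ 2 * Real.sqrt (x * X33 x) / τ x) →
    τ' = (fun x => Y3 x / yb x) →
    (∀ x, e₁ ≤ x → yb x + y₁ < 0 ∧ 0 < 4 * x ^ 2 + 4 * x * x₁ + 4 * x₁ ^ 2 - g₂) ∧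
    (∀ x, e₁ < x → e₁ < τ x →
      HasDerivAt τ (τ' x) x ∧ τ' x ≠ 0 ∧ |τ' x| * Real.sqrt (f x) = Real.sqrt (f (τ x)) ∧
      Y3 x ^ 2 = f (τ x)) ∧
    (∀ x, e₁ < x → e₁ < τ x → τ x < x₁ →
      Y3 x + y₁ ≠ 0 ∧ e₁ ≤ X33 x ∧ Pg x ≠ 0 ∧ G x ≠ 0 ∧
      HasDerivAt G (G x * ((Qf3 x - Qf x) / yb x)) x) ∧
    ((∀ x, τ x ≠ 0 → x ≠ 0 → ContinuousAt Qf x) ∧ Continuous τ ∧ Continuous Y3 ∧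
      (∀ x, e₁ < x → τ x ≠ 0 →
        HasDerivAt Qf (((g₂ * τ x + 2 * g₃) / (4 * τ x ^ 2) - (g₂ * x + 2 * g₃) / (4 * x ^ 2)) / yb x) x)) ∧
    (∀ S : Set ℝ, IsSemialgebraic ℚ {t : Fin 1 → ℝ | t 0 ∈ S} →
      IsSemialgebraicFunOn ℚ {t : Fin 1 → ℝ | t 0 ∈ S} (fun t => τ (t 0)) ∧
      IsSemialgebraicFunOn ℚ {t : Fin 1 → ℝ | t 0 ∈ S} (fun t => Y3 (t 0)) ∧
      IsSemialgebraicFunOn ℚ {t : Fin 1 → ℝ | t 0 ∈ S} (fun t => Qf (t 0)) ∧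
      IsSemialgebraicFunOn ℚ {t : Fin 1 → ℝ | t 0 ∈ S} (fun t => Qf3 (t 0)) ∧
      IsSemialgebraicFunOn ℚ {t : Fin 1 → ℝ | t 0 ∈ S} (fun t => G (t 0)) ∧
      IsSemialgebraicFunOn ℚ {t : Fin 1 → ℝ | t 0 ∈ S} (fun t => yb (t 0)) ∧
      IsSemialgebraicFunOn ℚ {t : Fin 1 → ℝ | t 0 ∈ S} (fun t => τ' (t 0))) ∧
    (e₁ ≤ xm1 → (∀ x, xm1 < x → e₁ < τ x) → xm1 < x₁ → ∀ x, xm1 < x → Y3 x < 0) ∧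
    (∀ x, e₁ < x → e₁ < τ x → Y3 x < 0 → Qf3 x = Qf (τ x) ∧ X33 x = τ (τ x) ∧ Y3 x = yb (τ x)) := by
  intro g₂ g₃ e₁ x₁ y₁ x₂ y₂ L₁ xm1 f yb sl τ Y3 Qf sl3 X33 Y33 Qf3 Pg G τ' hf he he0 hpos hx₁ hy₁ hy₁0
    hL hx₂ hy₂ hx₂e hy₂0 ag₂ ag₃ ax₁ ay₁ hyb hsl hτ hY3 hQf hsl3 hX33 hY33 hQf3 hPg hG hτ'
  /- ## Pointwise unfoldings of the formula functions -/
  have hybx : ∀ x, yb x = -Real.sqrt (f x) := fun x => by rw [hyb]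
  have hslx : ∀ x, sl x = (4 * x ^ 2 + 4 * x * x₁ + 4 * x₁ ^ 2 - g₂) / (yb x + y₁) := fun x => by
    rw [hsl]
  have hτx : ∀ x, τ x = sl x ^ 2 / 4 - x - x₁ := fun x => by rw [hτ]
  have hY3x : ∀ x, Y3 x = -(yb x + sl x * (τ x - x)) := fun x => by rw [hY3]
  have hQfx : ∀ x, Qf x = sl x / 2 + Y3 x / (2 * τ x) - yb x / (2 * x) := fun x => by rw [hQf]
  have hsl3x : ∀ x, sl3 x = (4 * τ x ^ 2 + 4 * τ x * x₁ + 4 * x₁ ^ 2 - g₂) / (Y3 x + y₁) :=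
    fun x => by rw [hsl3]
  have hX33x : ∀ x, X33 x = sl3 x ^ 2 / 4 - τ x - x₁ := fun x => by rw [hX33]
  have hY33x : ∀ x, Y33 x = -(Y3 x + sl3 x * (X33 x - τ x)) := fun x => by rw [hY33]
  have hQf3x : ∀ x, Qf3 x = sl3 x / 2 + Y33 x / (2 * X33 x) - Y3 x / (2 * τ x) := fun x => by
    rw [hQf3]
  have hPgx : ∀ x, Pg x = 4 * (x + 2 * x₁) * y₁ - L₁ * (4 * x ^ 2 + 4 * x * x₁ + 4 * x₁ ^ 2 - g₂)
      + 4 * (x + 2 * x₁) * yb x := fun x => by rw [hPg]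
  have hGx : ∀ x, G x = Pg x / (yb x + y₁) ^ 2 * Real.sqrt (x * X33 x) / τ x := fun x => by rw [hG]
  have hτ'x : ∀ x, τ' x = Y3 x / yb x := fun x => by rw [hτ']
  /- ## The denominator `yb + y₁ < 0`, the landed calculus with `ε = -1`, monotonicity of `f` -/
  have hyb_le : ∀ x, yb x ≤ 0 := fun x => by rw [hybx]; exact neg_nonpos.2 (Real.sqrt_nonneg _)
  have hden : ∀ x, yb x + y₁ < 0 := fun x => by linarith [hyb_le x]
  have hne : ∀ x, yb x + y₁ ≠ 0 := fun x => (hden x).ne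
  have hyb' : yb = fun x => (-1) * Real.sqrt (f x) := by
    rw [hyb]
    funext x
    rw [neg_one_mul]
  obtain ⟨hcurve, hderiv, hQfd, -⟩ := stub_translationCalculus g₂ g₃ x₁ y₁ (-1) f yb sl τ Y3 Qf hf hy₁
    (Or.inr rfl) hyb' hsl hτ hY3 hQf
  obtain ⟨hGpart, hnorm, hAx₂, hy₂sq⟩ := stub_dlogPotential g₂ g₃ x₁ y₁ x₂ y₂ L₁ (-1) f yb sl τ Y3 Qf
    sl3 X33 Y33 Qf3 Pg G hf hy₁ hy₁0.ne (Or.inr rfl) hL hx₂ hy₂ hyb' hsl hτ hY3 hQf hsl3 hX33 hY33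
    hQf3 hPg hG
  have hMpos : ∀ x, e₁ ≤ x → 0 < 4 * x ^ 2 + 4 * x * x₁ + 4 * x₁ ^ 2 - g₂ := fun x hx =>
    lowerReg_M_pos hf he hpos hx₁ hx (by linarith)
  have hyb2 : ∀ x, e₁ < x → yb x ^ 2 = f x := fun x hx => by
    rw [hybx, neg_sq, Real.sq_sqrt (hpos x hx).le]
  have hyb0 : ∀ x, e₁ < x → yb x ≠ 0 := fun x hx => by
    rw [hybx]; exact neg_ne_zero.2 (Real.sqrt_pos.2 (hpos x hx)).ne'
  /- ## Continuity -/
  have hfc : Continuous f := by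
    rw [show f = fun x => 4 * x ^ 3 - g₂ * x - g₃ from funext hf]
    fun_prop
  have hybc : Continuous yb := by rw [hyb]; fun_prop
  have hslc : Continuous sl := by
    rw [hsl]
    exact (by fun_prop : Continuous fun x : ℝ => 4 * x ^ 2 + 4 * x * x₁ + 4 * x₁ ^ 2 - g₂).div
      (hybc.add continuous_const) hne
  have hτc : Continuous τ := by rw [hτ]; fun_prop
  have hY3c : Continuous Y3 := by rw [hY3]; fun_prop
  /- ## Values at `x₁`: the tangential point -/
  have hybx₁ : yb x₁ = y₁ := by
    rw [hybx, ← hy₁, Real.sqrt_sq_eq_abs, abs_of_neg hy₁0, neg_neg]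
  have hslx₁ : sl x₁ = L₁ := by
    rw [hslx, hybx₁, hL]
    congr 1 <;> ring
  have hτx₁ : τ x₁ = x₂ := by
    rw [hτx, hslx₁, hx₂]
    ring
  have hY3x₁ : Y3 x₁ = y₂ := by
    rw [hY3x, hybx₁, hslx₁, hτx₁, hy₂]
  refine ⟨fun x hx => ⟨hden x, hMpos x hx⟩, ?_, ?_, ⟨?_, hτc, hY3c, ?_⟩, ?_, ?_, ?_⟩
  · /- ## (2) Haar invariance of the translation -/
    intro x hx hτ1
    have hfx := hpos x hx
    have hc := hcurve x hfx (hne x)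
    have hsq0 : Real.sqrt (f x) ≠ 0 := (Real.sqrt_pos.2 hfx).ne'
    have hY30 : Y3 x ≠ 0 := fun h0 => by
      rw [h0] at hc
      have h := hpos _ hτ1
      rw [← hc] at h
      norm_num at h
    refine ⟨by rw [hτ'x]; exact hderiv x hfx (hne x), by rw [hτ'x]; exact div_ne_zero hY30 (hyb0 x hx),
      ?_, hc⟩
    rw [hτ'x, abs_div, hybx x, abs_neg, abs_of_nonneg (Real.sqrt_nonneg _), div_mul_cancel₀ _ hsq0,
      ← Real.sqrt_sq_eq_abs, hc]
  · /- ## (3) Non-degeneracy on a cell and the dlog identity -/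
    intro x hx hτ1 hτ2
    have hfx := hpos x hx
    have hc := hcurve x hfx (hne x)
    -- `Y3 + y₁ ≠ 0`: else `f (τ x) = f x₁` with `e₁ < τ x < x₁`
    have hD3 : Y3 x + y₁ ≠ 0 := by
      intro h0
      have hY : Y3 x = -y₁ := by linarith
      have h : f (τ x) = f x₁ := by rw [← hc, hY, neg_sq, hy₁]
      exact absurd h (gridData_cubic_lt hf he he0 hpos hτ1.le hτ2).ne
    -- `e₁ ≤ X33 x`: the third intersection of the chord through `(τ x, Y3 x)` and `P₁`
    have hM3 : sl3 x * (Y3 x + y₁) = 4 * τ x ^ 2 + 4 * τ x * x₁ + 4 * x₁ ^ 2 - g₂ := by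
      rw [hsl3x]; exact div_mul_cancel₀ _ hD3
    have hX33e : e₁ ≤ X33 x := by
      rw [hX33x]
      exact lowerReg_third_root (hc.trans (hf _)) (hy₁.trans (hf x₁)) hM3 hD3
        ((hf e₁).symm.trans he) hτ1 hx₁
    -- `Pg x ≠ 0`: norm identity, `M ≠ 0`, and the value at `x₂`
    have hPx : Pg x ≠ 0 := by
      intro h0
      have hA : 4 * (x + 2 * x₁) * y₁ - L₁ * (4 * x ^ 2 + 4 * x * x₁ + 4 * x₁ ^ 2 - g₂)
          = -(4 * (x + 2 * x₁) * yb x) := by linarith [hPgx x]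
      have h1 : -4 * (x - x₂) * (4 * x ^ 2 + 4 * x * x₁ + 4 * x₁ ^ 2 - g₂) ^ 2 = 0 := by
        rw [← hnorm x, hA, ← hyb2 x hx]
        ring
      have hM0 : (4 * x ^ 2 + 4 * x * x₁ + 4 * x₁ ^ 2 - g₂) ^ 2 ≠ 0 := pow_ne_zero 2 (hMpos x hx.le).ne'
      have hxx₂ : x = x₂ := by
        rcases mul_eq_zero.1 h1 with h | h
        · rcases mul_eq_zero.1 h with h | h
          · norm_num at h
          · linarith
        · exact absurd h hM0
      have hybx₂ : yb x₂ = y₂ := by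
        rw [hybx, ← hy₂sq, Real.sqrt_sq_eq_abs, abs_of_neg hy₂0, neg_neg]
      rw [hxx₂] at h0
      have hP2 : Pg x₂ = 8 * (x₂ + 2 * x₁) * y₂ := by
        rw [hPgx, hybx₂]
        linear_combination hAx₂
      rw [hP2] at h0
      have hneg : 8 * (x₂ + 2 * x₁) * y₂ < 0 := mul_neg_of_pos_of_neg (by linarith) hy₂0
      exact hneg.ne h0
    have h := hGpart x hfx (hne x) hD3 (he0.trans hτ1) (he0.trans_le hX33e) (he0.trans hx) hPx
    exact ⟨hD3, hX33e, hPx, h.2, h.1⟩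
  · /- ## (4a) Continuity of the potential -/
    intro x hτ0 hx0
    rw [hQf]
    have h1 : ContinuousAt (fun x => sl x / 2) x := (hslc.div_const 2).continuousAt
    have h2 : ContinuousAt (fun x => Y3 x / (2 * τ x)) x :=
      hY3c.continuousAt.div (by fun_prop : Continuous fun x => 2 * τ x).continuousAt
        (mul_ne_zero two_ne_zero hτ0)
    have h3 : ContinuousAt (fun x => yb x / (2 * x)) x :=
      hybc.continuousAt.div (by fun_prop : Continuous fun x : ℝ => 2 * x).continuousAt
        (mul_ne_zero two_ne_zero hx0)
    exact (h1.add h2).sub h3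
  · /- ## (4b) The derivative of the potential -/
    intro x hx hτ0
    exact hQfd x (hpos x hx) (hne x) hτ0 (he0.trans hx).ne'
  · /- ## (5) Semialgebraicity of the formula functions -/
    intro S hS
    have hX : IsSemialgebraicFunOn ℚ {t : Fin 1 → ℝ | t 0 ∈ S} (fun t => t 0) :=
      (isSemialgebraicFunOn_aeval hS (MvPolynomial.X 0)).congr fun x _ => by simp
    have c {a : ℝ} (ha : IsAlgebraic ℚ a) :
        IsSemialgebraicFunOn ℚ {t : Fin 1 → ℝ | t 0 ∈ S} (fun _ => a) :=
      isSemialgebraicFunOn_const_of_isAlgebraic hS ha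
    have n (k : ℕ) [k.AtLeastTwo] :
        IsSemialgebraicFunOn ℚ {t : Fin 1 → ℝ | t 0 ∈ S} (fun _ => (OfNat.ofNat k : ℝ)) :=
      isSemialgebraicFunOn_const_ofNat hS k
    have syb : IsSemialgebraicFunOn ℚ {t : Fin 1 → ℝ | t 0 ∈ S} (fun t => yb (t 0)) :=
      (isSemialgebraicFunOn_sqrt_cubic_apply hS ag₂ ag₃ hf 0).fun_neg.congr fun t _ => by rw [hybx]
    have sM : IsSemialgebraicFunOn ℚ {t : Fin 1 → ℝ | t 0 ∈ S}
        (fun t => 4 * t 0 ^ 2 + 4 * t 0 * x₁ + 4 * x₁ ^ 2 - g₂) :=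
      isSemialgebraicFunOn_chordM_apply hS ag₂ ax₁ 0
    have ssl : IsSemialgebraicFunOn ℚ {t : Fin 1 → ℝ | t 0 ∈ S} (fun t => sl (t 0)) :=
      (cornerUp_fun_div sM (syb.fun_add (c ay₁))).congr fun t _ => by rw [hslx]
    have sτ : IsSemialgebraicFunOn ℚ {t : Fin 1 → ℝ | t 0 ∈ S} (fun t => τ (t 0)) :=
      (((cornerUp_fun_div (ssl.fun_pow 2) (n 4)).fun_sub hX).fun_sub (c ax₁)).congr
        fun t _ => by rw [hτx]
    have sY3 : IsSemialgebraicFunOn ℚ {t : Fin 1 → ℝ | t 0 ∈ S} (fun t => Y3 (t 0)) :=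
      (syb.fun_add (ssl.fun_mul (sτ.fun_sub hX))).fun_neg.congr fun t _ => by rw [hY3x]
    have sQf : IsSemialgebraicFunOn ℚ {t : Fin 1 → ℝ | t 0 ∈ S} (fun t => Qf (t 0)) :=
      (((cornerUp_fun_div ssl (n 2)).fun_add (cornerUp_fun_div sY3 ((n 2).fun_mul sτ))).fun_sub
        (cornerUp_fun_div syb ((n 2).fun_mul hX))).congr fun t _ => by rw [hQfx]
    have sM3 : IsSemialgebraicFunOn ℚ {t : Fin 1 → ℝ | t 0 ∈ S}
        (fun t => 4 * τ (t 0) ^ 2 + 4 * τ (t 0) * x₁ + 4 * x₁ ^ 2 - g₂) :=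
      ((((n 4).fun_mul (sτ.fun_pow 2)).fun_add (((n 4).fun_mul sτ).fun_mul (c ax₁))).fun_add
        ((n 4).fun_mul ((c ax₁).fun_pow 2))).fun_sub (c ag₂)
    have ssl3 : IsSemialgebraicFunOn ℚ {t : Fin 1 → ℝ | t 0 ∈ S} (fun t => sl3 (t 0)) :=
      (cornerUp_fun_div sM3 (sY3.fun_add (c ay₁))).congr fun t _ => by rw [hsl3x]
    have sX33 : IsSemialgebraicFunOn ℚ {t : Fin 1 → ℝ | t 0 ∈ S} (fun t => X33 (t 0)) :=
      (((cornerUp_fun_div (ssl3.fun_pow 2) (n 4)).fun_sub sτ).fun_sub (c ax₁)).congr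
        fun t _ => by rw [hX33x]
    have sY33 : IsSemialgebraicFunOn ℚ {t : Fin 1 → ℝ | t 0 ∈ S} (fun t => Y33 (t 0)) :=
      (sY3.fun_add (ssl3.fun_mul (sX33.fun_sub sτ))).fun_neg.congr fun t _ => by rw [hY33x]
    have sQf3 : IsSemialgebraicFunOn ℚ {t : Fin 1 → ℝ | t 0 ∈ S} (fun t => Qf3 (t 0)) :=
      (((cornerUp_fun_div ssl3 (n 2)).fun_add (cornerUp_fun_div sY33 ((n 2).fun_mul sX33))).fun_sub
        (cornerUp_fun_div sY3 ((n 2).fun_mul sτ))).congr fun t _ => by rw [hQf3x]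
    have cL : IsSemialgebraicFunOn ℚ {t : Fin 1 → ℝ | t 0 ∈ S} (fun _ => L₁) :=
      (cornerUp_fun_div (((n 12).fun_mul ((c ax₁).fun_pow 2)).fun_sub (c ag₂))
        ((n 2).fun_mul (c ay₁))).congr fun t _ => by rw [hL]
    have sPg : IsSemialgebraicFunOn ℚ {t : Fin 1 → ℝ | t 0 ∈ S} (fun t => Pg (t 0)) :=
      (((((n 4).fun_mul (hX.fun_add ((n 2).fun_mul (c ax₁)))).fun_mul (c ay₁)).fun_sub
        (cL.fun_mul sM)).fun_add
        (((n 4).fun_mul (hX.fun_add ((n 2).fun_mul (c ax₁)))).fun_mul syb)).congr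
        fun t _ => by rw [hPgx]
    have sG : IsSemialgebraicFunOn ℚ {t : Fin 1 → ℝ | t 0 ∈ S} (fun t => G (t 0)) :=
      (cornerUp_fun_div ((cornerUp_fun_div sPg ((syb.fun_add (c ay₁)).fun_pow 2)).fun_mul
        (hX.fun_mul sX33).fun_sqrt) sτ).congr fun t _ => by rw [hGx]
    have sτ' : IsSemialgebraicFunOn ℚ {t : Fin 1 → ℝ | t 0 ∈ S} (fun t => τ' (t 0)) :=
      (cornerUp_fun_div sY3 syb).congr fun t _ => by rw [hτ'x]
    exact ⟨sτ, sY3, sQf, sQf3, sG, syb, sτ'⟩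
  · /- ## (6) The sign of `Y3` right of `x_{m-1}` (intermediate value theorem) -/
    intro hm1 hτm hm1x₁ x hx
    have hY3ne : ∀ z, xm1 < z → Y3 z ≠ 0 := fun z hz h0 => by
      have hc := hcurve z (hpos z (lt_of_le_of_lt hm1 hz)) (hne z)
      rw [h0] at hc
      have h := hpos _ (hτm z hz)
      rw [← hc] at h
      norm_num at h
    have hneg : Y3 x₁ < 0 := by rw [hY3x₁]; exact hy₂0
    by_contra hnot
    push Not at hnot
    have hsub : uIcc x₁ x ⊆ Ioi xm1 := fun z hz =>
      lt_of_lt_of_le (lt_inf_iff.2 ⟨hm1x₁, hx⟩) hz.1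
    obtain ⟨c, hc, hc0⟩ := intermediate_value_uIcc hY3c.continuousOn
      (show (0 : ℝ) ∈ uIcc (Y3 x₁) (Y3 x) from ⟨inf_le_left.trans hneg.le, hnot.trans le_sup_right⟩)
    exact hY3ne c (hsub hc) hc0
  · /- ## (7) Where `Y3 < 0` the iterated chord is the iterated translation -/
    intro x hx _hτ1 hlt
    have hc := hcurve x (hpos x hx) (hne x)
    have hY : Y3 x = yb (τ x) := by
      rw [hybx, ← hc, Real.sqrt_sq_eq_abs, abs_of_neg hlt, neg_neg]
    have hs3 : sl3 x = sl (τ x) := by rw [hsl3x, hslx (τ x), hY]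
    have hXX : X33 x = τ (τ x) := by rw [hX33x, hs3, hτx (τ x)]
    have hYY : Y33 x = Y3 (τ x) := by rw [hY33x, hs3, hXX, hY, hY3x (τ x)]
    refine ⟨?_, hXX, hY⟩
    rw [hQf3x, hQfx (τ x), hs3, hYY, hXX, hY]

end Summit.KontsevichZagierPeriods.KontsevichZagierPeriods.Cruxes.NeronTorsionSector.Translation

end
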